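import Summits.CriticalPhenomena.CardyFormulaZ2.Theorems.CardyAnchoredRigiditySubseqCardyTranslationPerturbation
import Summits.CriticalPhenomena.CardyFormulaZ2.Theorems.ModulusResponseSquarePinning
import Summits.CriticalPhenomena.CardyFormulaZ2.Theorems.CardyTensorRGPolyominoGaussianLawStubScalingIdentity

/-!
# Symmetries of the joint sequential limits of the bond-`ℤ²` crossing probabilities
# (crux `SubseqCardy`, stmt-CriticalPhenomena-5768, line `registered`: structure of joint limits, part 2)

Route `CardyAnchoredRigidity` (decl shared with `CardyLocalRigidity`), sub-problem `CardyFormulaZ2`.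
A JOINT SEQUENTIAL LIMIT is a pair (`u → 0⁺`, `g : ConformalRectangle → ℝ`) with
`bondDomainCrossingProb R (u n) → g R` for EVERY conformal rectangle `R` — the hypothesis shape of the
two open stubs S2 `stub_limitConformal` (⟺ item stmt-8266) and S3 `stub_conformalLimitIsCardy`
(⟺ item stmt-8271); by S1 (landed) such pairs exist along a subsequence of every mesh sequence. S2
asks that `g` factor through the conformal modulus. This file proves, unconditionally, the part of
that invariance which the lattice and Schramm–Smirnov's perturbation theory give — the generic first
lemmas of every attack on S2 (PPI upgrade of route `CardyMirrorMonotone`, rotation-to-conformal,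
scale-ergodic upgrades):

* `JointLimit.map_addLeft` / registered sub-goal `jointLimit_translationInvariant` — **every joint
  sequential limit is invariant under ALL translations of the plane**: `g (e + R) = g R`. Lattice
  translations are exact symmetries only for vectors of the mesh lattice (a crude-lattice vector at
  crude mesh `u n/√2` is a mesh point at mesh `u n`, `div_sqrt_two_mul_z`), which shrink with the mesh;
  the sub-mesh remainder is absorbed by the translation-UNIFORM perturbation bound of part 1
  (`crude_translate_perturb`) through the bond ≈ crude sandwich `stub_bondNearCrude`.
* `JointLimit.map_cellSymmetry`, `JointLimit.map_mul_I`, `JointLimit.map_conj` — invariance under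
  the point group `D₄` of `ℤ²` (quarter turn, complex conjugation; exact mesh by mesh,
  `discreteCrossingProb_image_plane`).
* `JointLimit.tendsto_dilate` — **dilation intertwining**: `R ↦ g (c·R)` is the joint limit along
  the meshes `u n / c` (exact scale covariance of the discretisation, `stub_scalingIdentity`); so
  the set of joint limits along all mesh sequences is dilation invariant, and dilation covariance of
  ONE `g` is exactly the missing, open ingredient.
* `JointLimit.abs_sub_map_le` — **continuity in the Schramm–Smirnov topology**: `|g (T R) - g R| ≤ ε`
  for every plane homeomorphism `T` moving the unit neighbourhood of `closure R` by at most
  `η(R, ε)` (`stub_DomainPerturbation` + `stub_bondNearCrude`).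

References: O. Schramm, S. Smirnov, Ann. Probab. 39 (2011) §1.3, §5; H. Duminil-Copin,
K. Kozlowski, D. Krachun, I. Manolescu, M. Oulamara, arXiv:2012.11672 (rotations — NOT used here);
G. Grimmett, *Percolation* (1999) §1.6.
-/

noncomputable section

namespace Summit.CriticalPhenomena.CardyFormulaZ2.Cruxes.SubseqCardy.Birth

open Set Filter Topology Metric MeasureTheory Complex
open Literature.Probability.RandomPlanarGeometry (ConformalRectangle MarkedDomain)
open Literature.Probability.LatticeModels
open Literature.Probability.Percolation (bondPercolation half embDomainCrossing bondDomainCrossingProb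
  discreteCrossingProb)
open Summit.CriticalPhenomena.CardyFormulaZ2.Theorems (tendsto_div_sqrt_two div_sqrt_two_mul_z)
open Summit.CriticalPhenomena.CardyFormulaZ2.Theorems.CornerLineDescent.SymmetricSeed (bondStdCrossingProb
  stub_DomainPerturbation)
open Summit.CriticalPhenomena.CardyFormulaZ2.Theorems.ModulusResponseSquarePinning
  (discreteCrossingProb_image_plane)
open Summit.CriticalPhenomena.CardyFormulaZ2.Cruxes.PolyominoGaussianLaw.Birth (stub_scalingIdentity)

namespace JointLimit

variable {u : ℕ → ℝ} {g : ConformalRectangle → ℝ}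

/-! ### Limits of asymptotically equal sequences -/

/-- Two rectangles whose crossing probabilities along `u` are eventually `ε`-close for every `ε`
have the same joint limit. [folklore] -/
theorem eq_of_forall_eventually_abs_sub_le
    (hg : ∀ R : ConformalRectangle, Tendsto (fun n => bondDomainCrossingProb R (u n)) atTop (𝓝 (g R)))
    {R R' : ConformalRectangle}
    (h : ∀ ε : ℝ, 0 < ε → ∀ᶠ n in atTop,
      |bondDomainCrossingProb R' (u n) - bondDomainCrossingProb R (u n)| ≤ ε) :
    g R' = g R := by
  have h1 : Tendsto (fun n => bondDomainCrossingProb R' (u n) - bondDomainCrossingProb R (u n)) atTop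
      (𝓝 (g R' - g R)) := (hg R').sub (hg R)
  have h0 : Tendsto (fun n => bondDomainCrossingProb R' (u n) - bondDomainCrossingProb R (u n)) atTop
      (𝓝 0) := by
    rw [Metric.tendsto_nhds]
    intro ε hε
    filter_upwards [h (ε / 2) (half_pos hε)] with n hn
    rw [Real.dist_eq, sub_zero]
    linarith
  exact sub_eq_zero.1 (tendsto_nhds_unique h1 h0)

/-- If the crossing probabilities of `R'` and `R` along `u` are eventually `ε`-close, so are their
joint limits. [folklore] -/
theorem abs_sub_le_of_eventually
    (hg : ∀ R : ConformalRectangle, Tendsto (fun n => bondDomainCrossingProb R (u n)) atTop (𝓝 (g R)))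
    {R R' : ConformalRectangle} {ε : ℝ}
    (h : ∀ᶠ n in atTop, |bondDomainCrossingProb R' (u n) - bondDomainCrossingProb R (u n)| ≤ ε) :
    |g R' - g R| ≤ ε :=
  le_of_tendsto (((hg R').sub (hg R)).abs) h

/-! ### The crude functional and the bond ≈ crude sandwich along `u` -/

/-- `bondStdCrossingProb` unfolded (for rewriting the sandwich `stub_bondNearCrude`). [folklore] -/
theorem bondStdCrossingProb_eq (R : ConformalRectangle) (δ : ℝ) :
    bondStdCrossingProb R δ = (bondPercolation (zdGraph 2) half).real
      (embDomainCrossing squareLatticeEmbedding.z R.carrier δ (R.arc 0) (R.arc 2)) := rfl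

/-- The bond ≈ crude sandwich along the mesh sequence: eventually
`|bondDomainCrossingProb R (u n) - bondStdCrossingProb R (u n / √2)| ≤ ε`. [folklore] -/
theorem eventually_abs_bond_sub_crude_le (hu : Tendsto u atTop (𝓝[>] (0 : ℝ))) (R : ConformalRectangle)
    {ε : ℝ} (hε : 0 < ε) :
    ∀ᶠ n in atTop, |bondDomainCrossingProb R (u n) - bondStdCrossingProb R (u n / Real.sqrt 2)| ≤ ε :=
  hu.eventually (stub_bondNearCrude R ε hε)

/-! ### Translation invariance -/

/-- Composition of translations of marked domains: `p + (e' + R) = (p + e') + R`. [folklore] -/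
theorem map_addLeft_map_addLeft (R : ConformalRectangle) (e' p : ℂ) :
    (R.map (Homeomorph.addLeft e')).map (Homeomorph.addLeft p) = R.map (Homeomorph.addLeft (p + e')) := by
  rw [MarkedDomain.map_map]
  congr 1
  ext z
  simp [add_assoc]

/-- **The crossing probabilities of a translate are asymptotically those of the rectangle, along any
mesh sequence**: for every `ε > 0`, eventually
`|bondDomainCrossingProb (e + R) (u n) - bondDomainCrossingProb R (u n)| ≤ ε`. Write
`e = p_n + e_n` with `p_n` the point of the mesh lattice `(u n)ℤ²` nearest to `e` (`‖e_n‖ ≤ u n`);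
translating by `p_n` is an exact symmetry of the crude functional at crude mesh `u n / √2`
(`bondStdCrossingProb_map_addLeft_lattice`), translating by `e_n` costs at most `ε` once
`u n ≤ l(R, ε)` (`crude_translate_perturb`, uniform in the translation), and bond ≈ crude at both
ends (`stub_bondNearCrude`). [folklore] -/
theorem eventually_abs_sub_map_addLeft_le (hu : Tendsto u atTop (𝓝[>] (0 : ℝ))) (R : ConformalRectangle)
    (e : ℂ) {ε : ℝ} (hε : 0 < ε) :
    ∀ᶠ n in atTop,
      |bondDomainCrossingProb (R.map (Homeomorph.addLeft e)) (u n) - bondDomainCrossingProb R (u n)| ≤ ε := by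
  have hε3 : 0 < ε / 3 := by positivity
  obtain ⟨l, hl, hpert⟩ := crude_translate_perturb R hε3
  have h1 := eventually_abs_bond_sub_crude_le hu (R.map (Homeomorph.addLeft e)) hε3
  have h2 := eventually_abs_bond_sub_crude_le hu R hε3
  have h3 : ∀ᶠ n in atTop, ∀ e' : ℂ, ‖e'‖ ≤ l →
      |bondStdCrossingProb (R.map (Homeomorph.addLeft e')) (u n / Real.sqrt 2) -
        bondStdCrossingProb R (u n / Real.sqrt 2)| ≤ ε / 3 :=
    (tendsto_div_sqrt_two.comp hu).eventually hpert
  have h4 : ∀ᶠ n in atTop, u n ∈ Ioo 0 l := hu.eventually (Ioo_mem_nhdsGT hl)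
  filter_upwards [h1, h2, h3, h4] with n hn1 hn2 hn3 hn4
  rw [mem_Ioo] at hn4
  -- the lattice part `p` and the sub-mesh remainder `e'` of the translation
  set v : Site 2 := nearestSite (u n) e with hv
  set p : ℂ := meshPoint (u n) v with hp
  set e' : ℂ := e - p with he'
  have hee : e = p + e' := by rw [he']; ring
  have hne : ‖e'‖ ≤ l := by
    have hd := dist_meshPoint_nearestSite_le hn4.1 e
    rw [he', ← dist_eq_norm, dist_comm]
    exact hd.trans hn4.2.le
  -- exact lattice invariance at crude mesh `u n / √2`, then the uniform perturbation bound
  have hlat : bondStdCrossingProb (R.map (Homeomorph.addLeft e)) (u n / Real.sqrt 2) =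
      bondStdCrossingProb (R.map (Homeomorph.addLeft e')) (u n / Real.sqrt 2) := by
    rw [hee, ← map_addLeft_map_addLeft, hp, ← div_sqrt_two_mul_z]
    exact bondStdCrossingProb_map_addLeft_lattice _ _ v
  have key := hn3 e' hne
  rw [← hlat] at key
  rw [abs_le] at hn1 hn2 key ⊢
  constructor <;> linarith [hn1.1, hn1.2, hn2.1, hn2.2, key.1, key.2]

/-- **Every joint sequential limit is translation invariant**: if along `u → 0⁺` the bond-`ℤ²`
crossing probabilities of every conformal rectangle converge to `g`, then `g (e + R) = g R` for
every conformal rectangle `R` and every vector `e ∈ ℂ`. [folklore] -/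
theorem map_addLeft (hu : Tendsto u atTop (𝓝[>] (0 : ℝ)))
    (hg : ∀ R : ConformalRectangle, Tendsto (fun n => bondDomainCrossingProb R (u n)) atTop (𝓝 (g R)))
    (R : ConformalRectangle) (e : ℂ) :
    g (R.map (Homeomorph.addLeft e)) = g R :=
  eq_of_forall_eventually_abs_sub_le hg fun _ hε => eventually_abs_sub_map_addLeft_le hu R e hε

/-! ### The point group of the lattice -/

/-- A cell symmetry of `ℤ²` (lattice map + plane isometry, e.g. the quarter turn and the axis
reflection) is an exact symmetry of `bondDomainCrossingProb`, mesh by mesh. [folklore] -/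
theorem bondDomainCrossingProb_map_cellSymmetry (s : CellSymmetry) (T : ℂ ≃ₜ ℂ)
    (hT : ∀ z, T z = s.plane z) (R : ConformalRectangle) (δ : ℝ) :
    bondDomainCrossingProb (R.map T) δ = bondDomainCrossingProb R δ := by
  have himg : ∀ X : Set ℂ, T '' X = s.plane '' X := fun X => image_congr fun z _ => hT z
  simp only [bondDomainCrossingProb, MarkedDomain.carrier_map, MarkedDomain.arc_map, himg]
  exact discreteCrossingProb_image_plane s half R.carrier δ (R.arc 0) (R.arc 2)

/-- **Joint sequential limits are invariant under the point group `D₄` of `ℤ²`**: for every cell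
symmetry `s` acting on the plane by `T`, `g (T R) = g R`. [folklore] -/
theorem map_cellSymmetry
    (hg : ∀ R : ConformalRectangle, Tendsto (fun n => bondDomainCrossingProb R (u n)) atTop (𝓝 (g R)))
    (s : CellSymmetry) (T : ℂ ≃ₜ ℂ) (hT : ∀ z, T z = s.plane z) (R : ConformalRectangle) :
    g (R.map T) = g R := by
  refine tendsto_nhds_unique (hg (R.map T)) ?_
  simp only [bondDomainCrossingProb_map_cellSymmetry s T hT]
  exact hg R

/-- Quarter-turn invariance of joint sequential limits: `g (i·R) = g R`. [folklore] -/
theorem map_mul_I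
    (hg : ∀ R : ConformalRectangle, Tendsto (fun n => bondDomainCrossingProb R (u n)) atTop (𝓝 (g R)))
    (T : ℂ ≃ₜ ℂ) (hT : ∀ z, T z = I * z) (R : ConformalRectangle) : g (R.map T) = g R :=
  map_cellSymmetry hg CellSymmetry.rot T (fun z => by rw [hT, CellSymmetry.rot_plane_apply]) R

/-- Mirror invariance of joint sequential limits: `g (R̄) = g R` (complex conjugation; the crossing
is still between the images of the arcs `0` and `2`). [folklore] -/
theorem map_conj
    (hg : ∀ R : ConformalRectangle, Tendsto (fun n => bondDomainCrossingProb R (u n)) atTop (𝓝 (g R)))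
    (T : ℂ ≃ₜ ℂ) (hT : ∀ z, T z = (starRingEnd ℂ) z) (R : ConformalRectangle) : g (R.map T) = g R :=
  map_cellSymmetry hg CellSymmetry.reflect T (fun z => by rw [hT, CellSymmetry.reflect_plane_apply]) R

/-! ### Dilations intertwine mesh sequences -/

/-- Exact scale covariance: the crossing probability of `c·R` at mesh `δ` is that of `R` at mesh
`δ / c`. [folklore] -/
theorem bondDomainCrossingProb_map_dilate {c : ℝ} (hc : 0 < c) (T : ℂ ≃ₜ ℂ)
    (hT : ∀ z, T z = (c : ℂ) * z) (R : ConformalRectangle) (δ : ℝ) :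
    bondDomainCrossingProb (R.map T) δ = bondDomainCrossingProb R (δ / c) := by
  have himg : ∀ X : Set ℂ, T '' X = (fun z : ℂ => (c : ℂ) * z) '' X := fun X => image_congr fun z _ => hT z
  have hδ : δ = c * (δ / c) := by field_simp
  simp only [bondDomainCrossingProb, MarkedDomain.carrier_map, MarkedDomain.arc_map, himg]
  conv_lhs => rw [hδ]
  exact stub_scalingIdentity R.carrier (R.arc 0) (R.arc 2) (δ / c) c hc

/-- **Dilations intertwine joint sequential limits**: if `g` is the joint limit along `u`, then
`R ↦ g (c·R)` is the joint limit along `u n / c` (which again tends to `0⁺`). Hence the family of all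
joint sequential limits is invariant under `g ↦ g (c · )`, and dilation covariance of a SINGLE `g`
— `g (c·R) = g R` — is precisely what is not known. [folklore] -/
theorem tendsto_dilate
    (hg : ∀ R : ConformalRectangle, Tendsto (fun n => bondDomainCrossingProb R (u n)) atTop (𝓝 (g R)))
    {c : ℝ} (hc : 0 < c) (T : ℂ ≃ₜ ℂ) (hT : ∀ z, T z = (c : ℂ) * z) (R : ConformalRectangle) :
    Tendsto (fun n => bondDomainCrossingProb R (u n / c)) atTop (𝓝 (g (R.map T))) := by
  simp only [← bondDomainCrossingProb_map_dilate hc T hT]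
  exact hg (R.map T)

/-- The rescaled mesh sequence still tends to `0⁺`. [folklore] -/
theorem tendsto_div_const (hu : Tendsto u atTop (𝓝[>] (0 : ℝ))) {c : ℝ} (hc : 0 < c) :
    Tendsto (fun n => u n / c) atTop (𝓝[>] (0 : ℝ)) := by
  refine tendsto_nhdsWithin_iff.2 ⟨?_, ?_⟩
  · have h : Tendsto (fun n => u n / c) atTop (𝓝 (0 / c)) :=
      (tendsto_nhdsWithin_iff.1 hu).1.div_const c
    rwa [zero_div] at h
  · filter_upwards [(tendsto_nhdsWithin_iff.1 hu).2] with n hn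
    exact div_pos hn hc

/-! ### Continuity in the Schramm–Smirnov topology -/

/-- **Every joint sequential limit is continuous under small deformations of the rectangle**: for
every `R` and `ε > 0` there is `η > 0` such that `|g (T R) - g R| ≤ ε` for every plane homeomorphism
`T` moving the points of `cthickening 1 (closure R.carrier)` by at most `η`
(`stub_DomainPerturbation` for the crude functional, bond ≈ crude at both ends). [folklore] -/
theorem abs_sub_map_le (hu : Tendsto u atTop (𝓝[>] (0 : ℝ)))
    (hg : ∀ R : ConformalRectangle, Tendsto (fun n => bondDomainCrossingProb R (u n)) atTop (𝓝 (g R)))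
    (R : ConformalRectangle) {ε : ℝ} (hε : 0 < ε) :
    ∃ η : ℝ, 0 < η ∧ ∀ T : ℂ ≃ₜ ℂ,
      (∀ z ∈ Metric.cthickening 1 (closure R.carrier), dist (T z) z ≤ η) → |g (R.map T) - g R| ≤ ε := by
  have hε3 : 0 < ε / 3 := by positivity
  obtain ⟨η, hη, hpert⟩ := stub_DomainPerturbation R (ε / 3) hε3
  refine ⟨η, hη, fun T hT => ?_⟩
  have h1 := eventually_abs_bond_sub_crude_le hu (R.map T) hε3
  have h2 := eventually_abs_bond_sub_crude_le hu R hε3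
  have h3 : ∀ᶠ n in atTop, |bondStdCrossingProb (R.map T) (u n / Real.sqrt 2) -
      bondStdCrossingProb R (u n / Real.sqrt 2)| ≤ ε / 3 :=
    (tendsto_div_sqrt_two.comp hu).eventually (hpert T hT)
  refine abs_sub_le_of_eventually hg ?_
  filter_upwards [h1, h2, h3] with n hn1 hn2 hn3
  rw [abs_le] at hn1 hn2 hn3 ⊢
  constructor <;> linarith [hn1.1, hn1.2, hn2.1, hn2.2, hn3.1, hn3.2]

end JointLimit

/-- **Registered sub-goal `jointLimit_translationInvariant` (line `registered`, lead c3) — every joint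
sequential limit of the bond-`ℤ²` crossing probabilities is translation invariant**: if `u n → 0⁺`
and `bondDomainCrossingProb R (u n) → g R` for every conformal rectangle `R`, then
`g (e + R) = g R` for every `R` and every `e ∈ ℂ` (`JointLimit.map_addLeft`). A necessary part of
the conformal invariance asked by S2 `stub_limitConformal`, proved unconditionally. [folklore] -/
theorem jointLimit_translationInvariant : ∀ u : ℕ → ℝ, Filter.Tendsto u Filter.atTop (nhdsWithin (0 : ℝ) (Set.Ioi 0)) → ∀ g : Literature.Probability.RandomPlanarGeometry.ConformalRectangle → ℝ, (∀ R : Literature.Probability.RandomPlanarGeometry.ConformalRectangle, Filter.Tendsto (fun n => Literature.Probability.Percolation.bondDomainCrossingProb R (u n)) Filter.atTop (nhds (g R))) → ∀ (R : Literature.Probability.RandomPlanarGeometry.ConformalRectangle) (e : ℂ), g (R.map (Homeomorph.addLeft e)) = g R :=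
  fun _ hu _ hg R e => JointLimit.map_addLeft hu hg R e

end Summit.CriticalPhenomena.CardyFormulaZ2.Cruxes.SubseqCardy.Birth

end
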